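import Summits.AtomisticToContinuum.HydrodynamicLimit.Theorems.InformationPercolationEnginePercolationClosesChaosForecastRobustDefs
import HarnessLib

/-!
# Forecast transfer of the line `equilibrium-forecast-chain-rule` (crux `InformationPercolationEngine.PercolationClosesChaos`,
stmt-AtomisticToContinuum-15178) — the WEIGHTED architecture of skeleton v9 (lead c4, line cycle 5)

Support file (`--supports stmt-AtomisticToContinuum-15178`, registered helper `kineticCellChaosLG_of_w`). It proves the composition the
vocabulary file `…ForecastRobustDefs` (p154257) was designed for:

  `kineticCellChaosLG_of_w : ForecastSwap → BadForecastRareB → NonGoodRareW → RevealedSandwich → ForecastAlgebra → ForecastSplitW →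
     KineticCellChaosLG`

(H1, H2_B, H3_W, H4, H5, H5_W ⟹ the engine's output), replacing `kineticCellChaosLG_of` (v5, `…ForecastTransferArch` p140186) whose third
hypothesis `NonGoodRare` was a FRACTION statement. The chain (means `m(·) = unitMean … LG`, `Ĝ = gForecast`, `J = Jng`, `X̃, R` from H4):

  `m(bW_η) ≤ m(X̃)` (H5 i) `≤ m(Ĝ X̃) + ε` (H1) `≤ m(Ĝ(J·X̃)) + δₘ·h³·#box + T·m(𝟙{GoodB ∧ δₘ < Ĝ bW_{η/2}}) + m(Ĝ R) + ε` (H5_W.1)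
  `≤ m(J·X̃) + m(R) + 3ε + 27 δₘ + T δ₂` (H1 on `J·X̃` and on `R`, H2_B, `h³ #box ≤ 27`) `≤ m(J·min(ownedCount,T)) + 2 m(R) + 3ε + 27δₘ + Tδ₂`
  (H5_W.2) `≤ δ₃ + 2 δ₄ + 3ε + 27 δₘ + T δ₂ = δ` (H3_W, H4) with `ε = δ₃ = δ₄ = δ/10`, `δₘ = δ/135`, `δ₂ = δ/(5T)`; then H5 (iv).

`J·X̃` qualifies for H1: values in `[0, T]` (`Jng ∈ [0,1]`), vanishing off the box (as `X̃` does), and revealed (`jng_revealed` and the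
revealedness of `X̃`). Quantifiers: `σ₀ := min(σ₁ of H2_B, σ₀(φs) of H3_W, σ₀ of H4, 1/2)`; `ϑs := 1`; `ϑ, c₀` from H2_B; `c₀`'s of H3_W,
H4; for `c ≥ max c₀`: `b := min` of the three `b₀(c)` (H2_B, H3_W, H4 all hold for every `0 < b ≤ b₀`); `N₀ := max`.
-/

noncomputable section

open MeasureTheory Set Filter Topology
open scoped ENNReal BigOperators Classical
open Literature.Analysis.FluidPDE Literature.MathematicalPhysics.KineticTheory
open Literature.MathematicalPhysics.KineticTheory.VelocityBlindPlacement

namespace Summit.AtomisticToContinuum.HydrodynamicLimit.Theorems.EquilibriumForecastLine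

/-- **Registered helper `kineticCellChaosLG_of_w` (architecture of the WEIGHTED forecast transfer, skeleton v9):
`H1 → H2_B → H3_W → H4 → H5 → H5_W → KineticCellChaosLG`** — see the module docstring for the chain and the quantifier bookkeeping. [folklore] -/
theorem kineticCellChaosLG_of_w : ForecastSwap → BadForecastRareB → NonGoodRareW → RevealedSandwich → ForecastAlgebra → ForecastSplitW → KineticCellChaosLG := by
  intro h1 h2 h3 h4 h5 h6 a₀ θ₀ u₀ ha hθ hu ha0 hθ0
  obtain ⟨φs, hφs, σ₁, hσ₁, H2⟩ := h2
  obtain ⟨σ₃, hσ₃, H3⟩ := h3 φs hφs a₀ θ₀ u₀ ha hθ hu ha0 hθ0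
  obtain ⟨σ₄, hσ₄, H4⟩ := h4 a₀ θ₀ u₀ ha hθ hu ha0 hθ0
  refine ⟨min (min σ₁ σ₃) (min σ₄ (1 / 2)), by positivity, ?_⟩
  intro σ hσ hσlt Φ τ hτ Ψ hΨ hΨb η δ T hη hδ hT
  have hσ₁' : σ ≤ σ₁ := (hσlt.trans_le ((min_le_left _ _).trans (min_le_left _ _))).le
  have hσ₃' : σ < σ₃ := hσlt.trans_le ((min_le_left _ _).trans (min_le_right _ _))
  have hσ₄' : σ < σ₄ := hσlt.trans_le ((min_le_right _ _).trans (min_le_left _ _))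
  have hhalf : σ < 1 / 2 := hσlt.trans_le ((min_le_right _ _).trans (min_le_right _ _))
  -- tolerances and the thresholds of H2_B, H3_W, H4
  obtain ⟨ϑ, hϑ, c₂, hc₂, H2c⟩ := H2 a₀ θ₀ u₀ ha hθ hu ha0 hθ0 σ hσ hσ₁' hhalf.le Φ τ hτ Ψ hΨ hΨb 1 (η / 2) (δ / 135) T
    (δ / (5 * T)) one_pos (by positivity) (by positivity) hT (by positivity)
  obtain ⟨c₃, hc₃, H3c⟩ := H3 σ hσ hσ₃' Φ τ hτ 1 ϑ (δ / 10) T one_pos hϑ (by positivity) hT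
  obtain ⟨c₄, hc₄, H4c⟩ := H4 σ hσ hσ₄' Φ τ hτ Ψ hΨ hΨb η (δ / 10) T hη (by positivity) hT
  refine ⟨max (max c₂ c₃) c₄, lt_max_of_lt_right hc₄, fun c hc => ?_⟩
  have hc₂' : c₂ ≤ c := ((le_max_left _ _).trans (le_max_left _ _)).trans hc
  have hc₃' : c₃ ≤ c := ((le_max_right _ _).trans (le_max_left _ _)).trans hc
  have hc₄' : c₄ ≤ c := (le_max_right _ _).trans hc
  have hc0 : 0 < c := hc₄.trans_le hc₄'
  -- the bin width is chosen after `c`: the minimum of the three `b₀`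
  obtain ⟨b₂, hb₂, H2b⟩ := H2c c hc₂'
  obtain ⟨b₃, hb₃, H3b⟩ := H3c c hc₃'
  obtain ⟨b₄, hb₄, H4b⟩ := H4c c hc₄'
  set b : ℝ := min (min b₂ b₃) b₄ with hbdef
  have hb : 0 < b := lt_min (lt_min hb₂ hb₃) hb₄
  have hbb₂ : b ≤ b₂ := (min_le_left _ _).trans (min_le_left _ _)
  have hbb₃ : b ≤ b₃ := (min_le_left _ _).trans (min_le_right _ _)
  have hbb₄ : b ≤ b₄ := min_le_right _ _
  obtain ⟨N₂, H2N⟩ := H2b b hb hbb₂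
  obtain ⟨N₃, H3N⟩ := H3b b hb hbb₃
  obtain ⟨N₄, H4N⟩ := H4b b hb hbb₄
  obtain ⟨N₁, H1N⟩ := h1 a₀ θ₀ u₀ ha hθ hu ha0 hθ0 σ hσ hhalf.le Φ τ hτ T hT c hc0 (δ / 10) (by positivity)
  obtain ⟨N₆, H6⟩ := exists_mesh_le_one hσ c
  refine ⟨max (max (max N₁ N₂) (max N₃ N₄)) N₆, fun N hN => ?_⟩
  have hN₁ : N₁ ≤ N := ((le_max_left _ _).trans ((le_max_left _ _).trans (le_max_left _ _))).trans hN
  have hN₂ : N₂ ≤ N := ((le_max_right _ _).trans ((le_max_left _ _).trans (le_max_left _ _))).trans hN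
  have hN₃ : N₃ ≤ N := ((le_max_left _ _).trans ((le_max_right _ _).trans (le_max_left _ _))).trans hN
  have hN₄ : N₄ ≤ N := ((le_max_right _ _).trans ((le_max_right _ _).trans (le_max_left _ _))).trans hN
  have hN₆ : N₆ ≤ N := (le_max_right _ _).trans hN
  -- the revealed majorant and remainder
  obtain ⟨X, R, hXb, hRb, hX0, hR0, hXa, hRa, hdom, hsand, hmR⟩ := H4N N hN₄
  obtain ⟨h5i, -, -, h5iv⟩ := h5 a₀ θ₀ u₀ ha hθ hu ha0 hθ0 σ hσ hhalf N (Φ N) τ hτ Ψ hΨ hΨb η T c b hη hT hc0 hb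
  obtain ⟨h6i, h6ii⟩ := h6 a₀ θ₀ u₀ ha hθ hu ha0 hθ0 σ hσ hhalf N (Φ N) τ hτ Ψ hΨ hΨb (η / 2) T c b (by positivity) hT hc0 hb
    1 ϑ φs (δ / 135) (by positivity) X R hXb hRb hX0 hR0 hXa hRa hsand
  -- the weighted family `J · X̃` qualifies for the forecast swap
  set Y : ℕ → Cell → Phase N → ℝ := fun k q z => Jng b 1 ϑ φs c σ N (Φ N) k q z * X k q z with hYdef
  have hYb : ∀ k q z, 0 ≤ Y k q z ∧ Y k q z ≤ T := by
    intro k q z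
    have hJ := Jng_mem_Icc b 1 ϑ φs c σ N (Φ N) k q z
    have hX := hXb k q z
    refine ⟨mul_nonneg hJ.1 hX.1, ?_⟩
    calc Jng b 1 ϑ φs c σ N (Φ N) k q z * X k q z ≤ 1 * X k q z :=
          mul_le_mul_of_nonneg_right hJ.2 hX.1
      _ ≤ T := by rw [one_mul]; exact hX.2
  have hY0 : ∀ k, ∀ q ∉ cellBox (c * meanFreePath σ N), Y k q = fun _ => 0 := by
    intro k q hq
    funext z
    simp only [hYdef, hX0 k q hq, mul_zero]
  have hYa : ∀ k q, q ∈ cellBox (c * meanFreePath σ N) → ∀ z z',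
      seqHistLE b c σ N (Φ N) k q z = seqHistLE b c σ N (Φ N) k q z' → Y k q z = Y k q z' := by
    intro k q hq z z' hzz
    simp only [hYdef, hXa k q hq z z' hzz, jng_revealed b 1 ϑ φs c σ N (Φ N) k q z z' hzz]
  -- the chain
  have e1 := h5i X hXb hX0 hXa hdom
  have e2 := H1N N hN₁ b hb X hXb hX0 hXa
  have e3 := H1N N hN₁ b hb Y hYb hY0 hYa
  have e4 := H1N N hN₁ b hb R hRb hR0 hRa
  have e6 := H2N N hN₂
  have e7 := H3N N hN₃
  have e8 : (c * meanFreePath σ N) ^ 3 * ((cellBox (c * meanFreePath σ N)).card : ℝ) ≤ 27 :=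
    card_cellBox_mul_le (mul_pos hc0 (meanFreePath_pos hσ N)) (H6 N hN₆)
  rw [h5iv]
  refine ENNReal.ofReal_le_ofReal ?_
  rw [abs_le] at e2 e3 e4
  have e9 : δ / 135 * ((c * meanFreePath σ N) ^ 3 * ((cellBox (c * meanFreePath σ N)).card : ℝ)) ≤ δ / 135 * 27 :=
    mul_le_mul_of_nonneg_left e8 (by positivity)
  have e10 := mul_le_mul_of_nonneg_left e6 hT.le
  have e12 : T * (δ / (5 * T)) = δ / 5 := by field_simp
  linarith [h6i, h6ii, e1, e2.1, e2.2, e3.1, e3.2, e4.1, e4.2, e7, e9, e10, hmR]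

end Summit.AtomisticToContinuum.HydrodynamicLimit.Theorems.EquilibriumForecastLine

end
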